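import Summits.Ventures.CertifiedQuantumChemistry.Certificates.HubbardRingL4SingletDualCheck0
import Summits.Ventures.CertifiedQuantumChemistry.Certificates.HubbardRingL4SingletDualCheck1
import Summits.Ventures.CertifiedQuantumChemistry.Certificates.HubbardRingL4SingletDualCheck2
import Summits.Ventures.CertifiedQuantumChemistry.Certificates.HubbardRingL4SingletDualCheck3
import Summits.Ventures.CertifiedQuantumChemistry.Certificates.HubbardRingL4SingletDualCheck4
import Summits.Ventures.CertifiedQuantumChemistry.Certificates.HubbardRingL4SectorDualSound
import Summits.Ventures.CertifiedQuantumChemistry.Rows.HubbardRingStrongCouplingLimit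
import Summits.Ventures.CertifiedQuantumChemistry.Rows.HubbardRingTVWeakCoupling
import HarnessLib

/-!
# Ventures/CertifiedQuantumChemistry — Certificates/HubbardRingL4SingletDualCeiling.lean: the KERNEL-GRADE CEILING of the
# half-filled Hubbard 4-ring at level `DQG + ⟨Ŝ²⟩ = 0` — `E_PQG(hubbardRingTV 4 1 U; N = 4, ⟨Ŝ²⟩ = 0) ≥ −12/U − (2065779/1024)/U³`
# for EVERY `U > 0`, hence `(U/4)·(E₀ − E_PQG^singlet) → 0` as `U → ∞` along `ℚ`: THE STRONG-COUPLING LIMIT EXISTS AND IS `0`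

HONEST FRAMING (verbatim): certified bounds for a stated model Hamiltonian in a stated basis; not a
claim about the real molecule beyond that model. Everything below concerns the `(2,2)`-sector of the cell's own model object
`hubbardRingTV 4 1 U` (the 4-site ring, `t = 1`) and the VALUE of its singlet-restricted two-positivity relaxation; no row of
`CERTIFIED.md`, no claim node; the conjecture leaves `Rows/ConjectureSU*.lean` are not edited.

Seat rdm-B (gen 44). ASSEMBLY of the explicit finite-`U` dual certificate family (`…SingletDualBlock*/Mult/Family/Check0…4.lean`,
format + soundness `…SectorDual.lean` / `…SectorDualSound.lean` / `…SectorDualPoly.lean`): at `ε = 1/U` the checked, positive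
semidefinite certificate gives, on EVERY singlet-feasible pair, `1024·Σ doublons − 2048ε·Σ bonds ≥ −12288ε² − 2065779ε⁴`, i.e.
(gen 39's `Re E = −2Σ bonds + U·Σ doublons`) **`pqgSingletEnergy_ge`**: `−12/U − (2065779/1024)/U³ ≤ Model.pqgSingletEnergy
(hubbardRingTV 4 1 U) 2` for every rational `U > 0` — the first LOWER bound on the relaxation VALUE of the ring that is uniform
in `U` at the scale `1/U` (a dual object; the floors of gens 40–43 were primal). With gen 38's `OPT_DQG+S² ≤ E₀(n, n)` (Lieb) and
the typer's `U·E₀(4; U) → −12` (`Rows/HubbardRingStrongCouplingLimit.lean`): **`scaled_singlet_gap_le`** (`0 ≤ (U/4)(E₀ − OPT) ≤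
(U·E₀ + 12)/4 + (2065779/4096)/U²`) and **`tendsto_scaled_singlet_gap`**: `Tendsto (fun U : ℚ => (U/4)·(Model.energy (hubbardRingTV 4 1 U)
2 2 − Model.pqgSingletEnergy (hubbardRingTV 4 1 U) 2)) atTop (𝓝 0)` — the `n = 2` `Tendsto` conjunct of `ConjectureSU2_DQGS2` /
`ConjectureSU_DQGS2` (`c 2 = 0`: `conjectureSU2_DQGS2_tendsto_two`, `eq_zero_of_clause`) at KERNEL grade, with NO appeal to the
X_∞ limit programmes or to CLAIM N. READING (rdm-B's, of its own files): at strong coupling the singlet-restricted two-positivity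
relaxation of the half-filled 4-ring is asymptotically EXACT to order `J = 4t²/U`: `c_{DQG+S²}(4) = 0`. The conjecture itself
(all `n`, monotonicity, the `L = 6` brackets) is neither proved nor refuted here. 0 sorry, 0 def; standard axioms.
-/

set_option linter.style.longLine false

namespace Summit.Ventures.CertifiedQuantumChemistry

namespace DualL4.Singlet

open Matrix Finset Filter Topology
open Literature.MathematicalPhysics.QuantumLattice Literature.MathematicalPhysics.QuantumChemistry
open Summit.Ventures.CertifiedQuantumChemistry.Hamiltonians

/-! ## §1 The family passes the check at every `ε`; its target and bound -/

/-- All five orders pass, hence every `ε`-combination passes (`DualL4.check_polyDual`). -/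
theorem check_all (ε : ℚ) : (polyDual dualAt ε).check = true :=
  check_polyDual dualAt (fun m => by fin_cases m; exacts [check0, check1, check2, check3, check4]) ε

/-- The target's doublon coefficient: `1024` (order `0`). -/
theorem cd_eq (ε : ℚ) : (polyDual dualAt ε).cd = 1024 := by
  simp [polyDual, dualAt, cdV, Fin.sum_univ_five]

/-- The target's bond coefficient: `−2048·ε` (order `1`). -/
theorem ch_eq (ε : ℚ) : (polyDual dualAt ε).ch = -2048 * ε := by
  simp [polyDual, dualAt, chV, Fin.sum_univ_five, mul_comm]

/-- The bound: `−12288·ε² − 2065779·ε⁴`. -/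
theorem mu_eq (ε : ℚ) : (polyDual dualAt ε).mu = -12288 * ε ^ 2 - 2065779 * ε ^ 4 := by
  simp [polyDual, dualAt, muV, Fin.sum_univ_five]
  ring

/-! ## §2 THE CEILING: a lower bound on the singlet-restricted DQG value, uniform in `U` at the scale `1/U` -/

/-- **`−12/U − (2065779/1024)/U³ ≤ E_PQG(hubbardRingTV 4 1 U; N = 4, ⟨Ŝ²⟩ = 0)` for every rational `U > 0`.** -/
theorem pqgSingletEnergy_ge (U : ℚ) (hU : 0 < U) :
    (-12 : ℝ) / U - (2065779 / 1024 : ℝ) / (U : ℝ) ^ 3 ≤ Model.pqgSingletEnergy (hubbardRingTV 4 1 U) 2 := by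
  rw [Model.pqgSingletEnergy, le_pqgSingletEnergy_iff _ _ _ (by simp)]
  intro γ Γ hf
  have h := (polyDual dualAt (1 / U)).le_of_check (check_all _) (posSemidef_zD _) (posSemidef_zQ _) (posSemidef_zG _) hf
  rw [cd_eq, ch_eq, mu_eq] at h
  rw [RingEnergy.hubbardRingTV_re_rdmEnergy_eq_of_feasible (by norm_num) 1 U hf.toIsDQGFeasibleSector]
  push_cast at h ⊢
  have hU' : (0 : ℝ) < U := by exact_mod_cast hU
  have hUne : (U : ℝ) ≠ 0 := hU'.ne'
  set D := ∑ p : Fin 4, (Γ (orb p 0, orb p 1) (orb p 0, orb p 1)).re with hD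
  set B := ∑ p : Fin 4, ∑ σ : Fin 2, (γ (orb p σ) (orb (finRotate 4 p) σ)).re with hB
  have key := mul_le_mul_of_nonneg_left h (le_of_lt (by positivity : (0 : ℝ) < U / 1024))
  have e1 : (U : ℝ) / 1024 * (1024 * D + -2048 * (1 / (U : ℝ)) * B) = -2 * (1 : ℝ) * B + (U : ℝ) * D := by
    field_simp; ring
  have e2 : (U : ℝ) / 1024 * (-12288 * (1 / (U : ℝ)) ^ 2 - 2065779 * (1 / (U : ℝ)) ^ 4) =
      (-12 : ℝ) / U - (2065779 / 1024 : ℝ) / (U : ℝ) ^ 3 := by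
    field_simp; ring
  linarith [key, e1, e2]

/-! ## §3 The scaled gap is squeezed to `0`: the strong-coupling limit EXISTS and equals `0` -/

/-- `0 ≤ (U/4)·(E₀ − OPT_DQG+S²)` on the 4-ring for `U > 0` (gen 38: `OPT_DQG+S² ≤ E₀(n,n)`, Lieb's singlet ground state). -/
theorem scaled_singlet_gap_nonneg (U : ℚ) (hU : 0 < U) :
    0 ≤ (U : ℝ) / 4 * (Model.energy (hubbardRingTV 4 1 U) 2 2 - Model.pqgSingletEnergy (hubbardRingTV 4 1 U) 2) := by
  have h := hubbardRingTV_pqgSingletEnergy_le_energy (n := 2) (by norm_num) 1 hU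
  have hU' : (0 : ℝ) ≤ U := by exact_mod_cast hU.le
  exact mul_nonneg (by positivity) (sub_nonneg.2 h)

/-- **`(U/4)·(E₀ − OPT_DQG+S²) ≤ (U·E₀ + 12)/4 + (2065779/4096)/U²`** for every rational `U > 0`. -/
theorem scaled_singlet_gap_le (U : ℚ) (hU : 0 < U) :
    (U : ℝ) / 4 * (Model.energy (hubbardRingTV 4 1 U) 2 2 - Model.pqgSingletEnergy (hubbardRingTV 4 1 U) 2)
      ≤ ((U : ℝ) * Model.energy (hubbardRingTV 4 1 U) 2 2 + 12) / 4 + (2065779 / 4096 : ℝ) / (U : ℝ) ^ 2 := by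
  have h := pqgSingletEnergy_ge U hU
  have hU' : (0 : ℝ) < U := by exact_mod_cast hU
  have h1 : (U : ℝ) / 4 * (Model.energy (hubbardRingTV 4 1 U) 2 2 - Model.pqgSingletEnergy (hubbardRingTV 4 1 U) 2) ≤
      (U : ℝ) / 4 * (Model.energy (hubbardRingTV 4 1 U) 2 2 - ((-12 : ℝ) / U - (2065779 / 1024 : ℝ) / (U : ℝ) ^ 3)) :=
    mul_le_mul_of_nonneg_left (by linarith) (by positivity)
  have e : (U : ℝ) / 4 * (Model.energy (hubbardRingTV 4 1 U) 2 2 - ((-12 : ℝ) / U - (2065779 / 1024 : ℝ) / (U : ℝ) ^ 3)) =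
      ((U : ℝ) * Model.energy (hubbardRingTV 4 1 U) 2 2 + 12) / 4 + (2065779 / 4096 : ℝ) / (U : ℝ) ^ 2 := by
    field_simp; ring
  linarith [h1, e]

/-- **THE STRONG-COUPLING LIMIT OF THE SCALED SINGLET-RESTRICTED GAP OF THE 4-RING EXISTS AND IS `0`**:
`(U/4)·(E₀(4;U) − OPT_DQG+S²(4;U)) → 0` as `U → ∞` along `ℚ` (squeeze between `0` and §3's bound; the `E₀` side is the typer's
`U·E₀ → −12`). -/
theorem tendsto_scaled_singlet_gap :
    Tendsto (fun U : ℚ => (U : ℝ) / 4 *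
      (Model.energy (hubbardRingTV 4 1 U) 2 2 - Model.pqgSingletEnergy (hubbardRingTV 4 1 U) 2)) atTop (𝓝 0) := by
  have hE := tendsto_mul_energy_hubbardRingTV_four
  have hcast : Tendsto (fun U : ℚ => (U : ℝ)) atTop atTop := tendsto_ratCast_atTop_iff.2 tendsto_id
  have hsq : Tendsto (fun U : ℚ => (U : ℝ) ^ 2) atTop atTop := (tendsto_pow_atTop two_ne_zero).comp hcast
  have hinv : Tendsto (fun U : ℚ => (2065779 / 4096 : ℝ) / (U : ℝ) ^ 2) atTop (𝓝 0) := tendsto_const_nhds.div_atTop hsq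
  have hg : Tendsto (fun U : ℚ => ((U : ℝ) * Model.energy (hubbardRingTV 4 1 U) 2 2 + 12) / 4 + (2065779 / 4096 : ℝ) / (U : ℝ) ^ 2)
      atTop (𝓝 (((-12 : ℝ) + 12) / 4 + 0)) := ((hE.add_const 12).div_const 4).add hinv
  rw [show ((-12 : ℝ) + 12) / 4 + 0 = 0 by norm_num] at hg
  refine tendsto_of_tendsto_of_tendsto_of_le_of_le' tendsto_const_nhds hg ?_ ?_
  · filter_upwards [eventually_gt_atTop (0 : ℚ)] with U hU using scaled_singlet_gap_nonneg U hU
  · filter_upwards [eventually_gt_atTop (0 : ℚ)] with U hU using scaled_singlet_gap_le U hU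

/-! ## §4 Read against the conjecture leaves (`Rows/ConjectureSU2.lean`, `Rows/ConjectureSU.lean`): the `n = 2` clause, `c 2 = 0` -/

/-- The `n = 2` instance of the `Tendsto` conjunct of `ConjectureSU2_DQGS2` / `ConjectureSU_DQGS2`, in the leaves' spelling
(`hubbardRingTV (2*n) 1 U` at `n = 2`), with the conjectured value `c 2 = 0`. -/
theorem conjectureSU2_DQGS2_tendsto_two :
    Tendsto (fun U : ℚ => ((U : ℝ) / 4) *
      (Model.energy (hubbardRingTV (2 * 2) 1 U) 2 2 - Model.pqgSingletEnergy (hubbardRingTV (2 * 2) 1 U) 2)) atTop (𝓝 0) :=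
  tendsto_scaled_singlet_gap

/-- **Any plateau function satisfying the conjecture's convergence clause has `c 2 = 0`** (limits along `atTop (ℚ)` are unique). -/
theorem eq_zero_of_clause {c : ℕ → ℝ}
    (h : ∀ n, 2 ≤ n → 0 ≤ c n ∧
      Tendsto (fun U : ℚ => ((U : ℝ) / 4) *
          (Model.energy (hubbardRingTV (2 * n) 1 U) n n - Model.pqgSingletEnergy (hubbardRingTV (2 * n) 1 U) n))
        atTop (𝓝 (c n))) :
    c 2 = 0 :=
  tendsto_nhds_unique (h 2 le_rfl).2 conjectureSU2_DQGS2_tendsto_two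

end DualL4.Singlet

end Summit.Ventures.CertifiedQuantumChemistry
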